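import Literature.NumberTheory.GaloisRepresentations.TameInertiaKummerProofs
import Literature.NumberTheory.GaloisRepresentations.TateUnramifiedLiftingReductionProofs
import Literature.NumberTheory.GaloisRepresentations.InertiaRootsOfUnity
import Literature.NumberTheory.Automorphic.LanglandsTetrahedral
import HarnessLib

/-!
# Frobenius acts trivially on a tame inertia image of order dividing `q - 1`

Topic `Literature/NumberTheory/GaloisRepresentations`; namespace
`Literature.NumberTheory.GaloisRepresentations`.  THEOREMS ONLY (no definition, no named fact).

Let `F` be a non-archimedean local field with residue field `𝓀` of characteristic `p` and order
`q`, `Γ_F` its absolute Galois group with inertia subgroup `I_F = absInertia F`, and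
`λ : Γ_F → H` a homomorphism with open kernel (a finite Galois-theoretic datum).

* `apply_frob_conj_eq_of_map_absInertia_eq_zpowers` — if `λ(I_F)` is cyclic of order `d` with
  `p ∤ d` and `d ∣ q - 1`, then `λ(φ σ φ⁻¹) = λ(σ)` for every arithmetic Frobenius `φ` and every
  `σ ∈ I_F`: conjugation by Frobenius acts on the tame inertia group `I_F / I_F^{wild}` through
  `u ↦ u^q` (Serre), and `u^q = u` on a quotient of exponent `d ∣ q - 1`.  Proof: embed
  `λ(I_F) ≃ μ_d(k)` into the units of the residue field `k = ℤ̄_F / 𝔓` (which contains `μ_d`,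
  `exists_isPrimitiveRoot_of_not_dvd`), so that `λ|_{I_F}` becomes a continuous character
  `χ : I_F → kˣ` of exponent `d`; by the tree's classification `exists_eq_kummerCharacter_pow_holds`
  (Serre 1972, §1.7 Prop. 5) `χ = θ_d^a` is a power of the Kummer character, and
  `θ_d(φσφ⁻¹) = θ_d(σ)^q` (`kummerCharacter_conj_apply`, Serre 1972 §1.8 Prop. 6).
* `exists_eq_frob_zpow_mul_of_isOpen_ker` — every `λ(τ)` is `λ(φ)ⁿ · λ(ι)` with `n ∈ ℤ`,
  `ι ∈ I_F` (`Γ_F / I_F` is pro-cyclic generated by Frobenius: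
  `IsNonarchimedeanLocalField.range_eq_zpowers_of_absInertia_le_ker`).
* `range_eq_zpowers_of_map_absInertia_eq_zpowers` — consequently, if moreover `λ(φ)` lies in the
  cyclic group `λ(I_F)` as soon as it commutes with its generator (e.g. the generator is a
  `5`-cycle in `S₅`, whose centraliser is the group it generates), then `λ(Γ_F) = λ(I_F)`: the
  decomposition image equals the inertia image ("type 3a" behaviour of a tamely and totally
  ramified prime `p ≡ 1 (mod d)`, Doud–Moore 2006 §2).

## References

* J.-P. Serre, *Propriétés galoisiennes des points d'ordre fini des courbes elliptiques*, Invent.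
  Math. 15 (1972), §1.3, §1.7 Prop. 5, §1.8 Prop. 6. [SerreInventiones1972]
* J.-P. Serre, *Local Fields*, GTM 67 (1979), Ch. IV §2. [SerreLocalFields1979]
* D. Doud, M. W. Moore, *Even icosahedral Galois representations of prime conductor*, J. Number
  Theory 118 (2006), §2. [DoudMoore2006]
-/

noncomputable section

open scoped Valued
open Field ValuativeRel

namespace Literature.NumberTheory.GaloisRepresentations

open GaloisRepresentations.IsNonarchimedeanLocalField

variable {F : Type*} [Field F] [ValuativeRel F] [TopologicalSpace F] [IsNonarchimedeanLocalField F]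

/-- **Every `λ(τ)` is `λ(φ)ⁿ · λ(ι)`, `ι` in inertia.**  For a homomorphism `λ : Γ_F → H` with
open kernel and an arithmetic Frobenius `φ`, every element of `λ(Γ_F)` is a power of `λ(φ)` times
an element of `λ(I_F)` (`Γ_F / I_F ≅ Ẑ` is topologically generated by Frobenius).
[cite: SerreLocalFields1979, Ch. IV §2] -/
theorem exists_eq_frob_zpow_mul_of_isOpen_ker {H : Type*} [Group H]
    (lam : absoluteGaloisGroup F →* H)
    (hopen : IsOpen ((lam.ker : Subgroup (absoluteGaloisGroup F)) : Set (absoluteGaloisGroup F)))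
    {φ : absoluteGaloisGroup F} (hφ : IsAbsArithFrob φ) (τ : absoluteGaloisGroup F) :
    ∃ (n : ℤ) (ι : absoluteGaloisGroup F), ι ∈ absInertia F ∧ lam τ = lam φ ^ n * lam ι := by
  classical
  set lam' : absoluteGaloisGroup F →* lam.range := lam.rangeRestrict with hlam'
  set N : Subgroup lam.range := (absInertia F).map lam' with hN
  haveI : N.Normal := Subgroup.Normal.map inferInstance lam' lam.rangeRestrict_surjective
  set h : absoluteGaloisGroup F →* lam.range ⧸ N := (QuotientGroup.mk' N).comp lam' with hh
  have hkerle : lam.ker ≤ h.ker := by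
    intro x hx
    rw [MonoidHom.mem_ker] at hx ⊢
    rw [hh, MonoidHom.comp_apply]
    have : lam' x = 1 := Subtype.ext (by rw [hlam', MonoidHom.coe_rangeRestrict, hx]; rfl)
    rw [this, map_one]
  have hker : IsOpen ((h.ker : Subgroup (absoluteGaloisGroup F)) : Set (absoluteGaloisGroup F)) :=
    Subgroup.isOpen_mono hkerle hopen
  have hI : absInertia F ≤ h.ker := by
    intro ι hι
    rw [MonoidHom.mem_ker, hh, MonoidHom.comp_apply, QuotientGroup.mk'_apply,
      QuotientGroup.eq_one_iff]
    exact Subgroup.mem_map_of_mem lam' hι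
  have hrange := IsNonarchimedeanLocalField.range_eq_zpowers_of_absInertia_le_ker h hker hI hφ
  have hτ : h τ ∈ Subgroup.zpowers (h φ) := hrange ▸ ⟨τ, rfl⟩
  obtain ⟨n, hn⟩ := Subgroup.mem_zpowers_iff.mp hτ
  have h1 : lam' ((φ ^ n)⁻¹ * τ) ∈ N := by
    rw [← QuotientGroup.eq_one_iff, ← QuotientGroup.mk'_apply, ← MonoidHom.comp_apply, ← hh,
      map_mul, map_inv, map_zpow, hn, inv_mul_cancel]
  obtain ⟨ι, hι, heq⟩ := Subgroup.mem_map.mp h1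
  refine ⟨n, ι, hι, ?_⟩
  have heq' : lam ι = lam ((φ ^ n)⁻¹ * τ) := by
    have := congrArg Subtype.val heq
    simpa [hlam'] using this
  rw [heq', map_mul, map_inv, map_zpow, ← mul_assoc, mul_inv_cancel, one_mul]

/-- **Frobenius acts trivially on a cyclic tame inertia image of order `d ∣ q - 1`.**  Let
`λ : Γ_F → H` have open kernel and map the inertia group onto a cyclic group `⟨g₀⟩` of order `d`
with `p ∤ d` and `d ∣ q - 1` (`p`, `q` the residue characteristic and cardinality).  Then
`λ(φ σ φ⁻¹) = λ(σ)` for every arithmetic Frobenius `φ` and `σ ∈ I_F`.  (The character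
`I_F → ⟨g₀⟩ ≃ μ_d(k) ⊆ kˣ`, `k` the residue field of `ℤ̄_F`, is a power of the Kummer character
`θ_d`, Serre 1972 §1.7 Prop. 5, and `θ_d(φσφ⁻¹) = θ_d(σ)^q = θ_d(σ)`, §1.8 Prop. 6.)
[cite: SerreInventiones1972, §1.7 Prop. 5 and §1.8 Prop. 6] -/
theorem apply_frob_conj_eq_of_map_absInertia_eq_zpowers {H : Type*} [Group H]
    (lam : absoluteGaloisGroup F →* H)
    (hopen : IsOpen ((lam.ker : Subgroup (absoluteGaloisGroup F)) : Set (absoluteGaloisGroup F)))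
    {g₀ : H} (hmap : (absInertia F).map lam = Subgroup.zpowers g₀)
    {d : ℕ} (hd : 0 < d) (hord : orderOf g₀ = d) (hpd : ¬ ringChar 𝓀[F] ∣ d)
    (hq : d ∣ residueFieldCard F - 1)
    {φ : absoluteGaloisGroup F} (hφ : IsAbsArithFrob φ)
    {σ : absoluteGaloisGroup F} (hσ : σ ∈ absInertia F) :
    lam (φ * σ * φ⁻¹) = lam σ := by
  classical
  -- coefficient field: the residue field `k = ℤ̄_F ⧸ 𝔓`, with the discrete topology
  haveI : (absMaximalIdeal F).IsMaximal := absMaximalIdeal_isMaximal_holds F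
  letI : Field (absIntegers 𝒪[F] F ⧸ absMaximalIdeal F) := Ideal.Quotient.field _
  letI : TopologicalSpace (absIntegers 𝒪[F] F ⧸ absMaximalIdeal F) := ⊥
  haveI : DiscreteTopology (absIntegers 𝒪[F] F ⧸ absMaximalIdeal F) := ⟨rfl⟩
  -- a primitive `d`-th root of unity in `k`, as a unit of order `d`
  obtain ⟨ζ, hζ⟩ := exists_isPrimitiveRoot_of_not_dvd (F := F)
    (k := absIntegers 𝒪[F] F ⧸ absMaximalIdeal F) (RingHom.id _) hd hpd
  set ζu : (absIntegers 𝒪[F] F ⧸ absMaximalIdeal F)ˣ := (hζ.isUnit hd.ne').unit with hζu_def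
  have hζu : IsPrimitiveRoot ζu d := IsPrimitiveRoot.isUnit_unit hd.ne' hζ
  have hordζ : orderOf ζu = d := hζu.eq_orderOf.symm
  -- `j : ⟨g₀⟩ ≃ ⟨ζu⟩ ⊆ kˣ` (two cyclic groups of order `d`)
  have hcardeq : Nat.card (Subgroup.zpowers g₀) = Nat.card (Subgroup.zpowers ζu) := by
    rw [Nat.card_zpowers, Nat.card_zpowers, hord, hordζ]
  set j : Subgroup.zpowers g₀ →* (absIntegers 𝒪[F] F ⧸ absMaximalIdeal F)ˣ :=
    (Subgroup.zpowers ζu).subtype.comp (mulEquivOfCyclicCardEq hcardeq).toMonoidHom with hj_def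
  have hj : Function.Injective j := by
    rw [hj_def, MonoidHom.coe_comp]
    exact (Subgroup.zpowers ζu).subtype_injective.comp (mulEquivOfCyclicCardEq hcardeq).injective
  -- `λ` maps inertia into `⟨g₀⟩`
  have hmapsto : ∀ τ : absoluteGaloisGroup F, τ ∈ absInertia F → lam τ ∈ Subgroup.zpowers g₀ :=
    fun τ hτ => hmap ▸ Subgroup.mem_map_of_mem lam hτ
  set lamI : absInertia F →* Subgroup.zpowers g₀ :=
    (lam.comp (absInertia F).subtype).codRestrict _ (fun τ => hmapsto τ τ.2) with hlamI_def
  have hlamI : ∀ τ : absInertia F, ((lamI τ : Subgroup.zpowers g₀) : H) = lam τ := fun τ => rfl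
  set χ : absInertia F →* (absIntegers 𝒪[F] F ⧸ absMaximalIdeal F)ˣ := j.comp lamI with hχ_def
  -- values of `χ` are `d`-torsion
  have hχd : ∀ τ, χ τ ^ d = 1 := by
    intro τ
    have hmem : χ τ ∈ Subgroup.zpowers ζu := by
      rw [hχ_def, MonoidHom.comp_apply, hj_def, MonoidHom.comp_apply]
      exact SetLike.coe_mem _
    obtain ⟨m, hm⟩ := Subgroup.mem_zpowers_iff.mp hmem
    rw [← hm, ← zpow_natCast, ← zpow_mul, mul_comm, zpow_mul, zpow_natCast, ← hordζ,
      pow_orderOf_eq_one, one_zpow]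
  -- continuity of `χ` (it factors through the continuous `λ|_{I_F}` into the discrete `H`)
  letI : TopologicalSpace H := ⊥
  haveI : DiscreteTopology H := ⟨rfl⟩
  have hlam_cont : Continuous lam :=
    Literature.NumberTheory.Automorphic.MonoidHom.continuous_of_isOpen_ker lam hopen
  have hχcont : Continuous χ := by
    let f : H → (absIntegers 𝒪[F] F ⧸ absMaximalIdeal F)ˣ :=
      fun x => if hx : x ∈ Subgroup.zpowers g₀ then j ⟨x, hx⟩ else 1
    have hfχ : ∀ τ : absInertia F, f (lam τ) = χ τ := by
      intro τ
      simp only [f, dif_pos (hmapsto τ τ.2)]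
      rfl
    have hc : Continuous fun τ : absInertia F => f (lam τ) :=
      (continuous_of_discreteTopology (f := f)).comp (hlam_cont.comp continuous_subtype_val)
    exact hc.congr hfχ
  -- a uniformiser, and the classification of exponent-`d` characters of `I_F`
  obtain ⟨ϖ, hϖ⟩ := IsDiscreteValuationRing.exists_irreducible 𝒪[F]
  obtain ⟨a, ha⟩ := exists_eq_kummerCharacter_pow_holds F (absIntegers 𝒪[F] F ⧸ absMaximalIdeal F)
    (RingHom.id _) hd hpd hϖ χ hχcont hχd
  -- conjugation by Frobenius multiplies Kummer characters by `q`
  have hconjmem : φ * σ * φ⁻¹ ∈ absInertia F := (inferInstance : (absInertia F).Normal).conj_mem σ hσ φ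
  have hφ1 : IsFrobPow φ 1 := IsAbsArithFrob.isFrobPow_holds hφ
  have key := kummerCharacter_conj_apply hd hϖ.ne_zero
    (RingHom.id (absIntegers 𝒪[F] F ⧸ absMaximalIdeal F)) hφ1 ⟨σ, hσ⟩ hconjmem
  rw [pow_one] at key
  have hχ1 : ((χ ⟨φ * σ * φ⁻¹, hconjmem⟩ : (absIntegers 𝒪[F] F ⧸ absMaximalIdeal F)ˣ) :
      absIntegers 𝒪[F] F ⧸ absMaximalIdeal F) =
      ((χ ⟨σ, hσ⟩ : (absIntegers 𝒪[F] F ⧸ absMaximalIdeal F)ˣ) :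
        absIntegers 𝒪[F] F ⧸ absMaximalIdeal F) ^ residueFieldCard F := by
    rw [ha, MonoidHom.pow_apply, MonoidHom.pow_apply, Units.val_pow_eq_pow_val,
      Units.val_pow_eq_pow_val, key, ← pow_mul, ← pow_mul, mul_comm]
  -- `x ^ q = x` for `x ^ d = 1` and `d ∣ q - 1`
  have hχ2 : ((χ ⟨σ, hσ⟩ : (absIntegers 𝒪[F] F ⧸ absMaximalIdeal F)ˣ) :
        absIntegers 𝒪[F] F ⧸ absMaximalIdeal F) ^ residueFieldCard F =
      ((χ ⟨σ, hσ⟩ : (absIntegers 𝒪[F] F ⧸ absMaximalIdeal F)ˣ) :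
        absIntegers 𝒪[F] F ⧸ absMaximalIdeal F) := by
    obtain ⟨t, ht⟩ := hq
    have hxd : ((χ ⟨σ, hσ⟩ : (absIntegers 𝒪[F] F ⧸ absMaximalIdeal F)ˣ) :
        absIntegers 𝒪[F] F ⧸ absMaximalIdeal F) ^ d = 1 := by
      rw [← Units.val_pow_eq_pow_val, hχd, Units.val_one]
    have hq1 : residueFieldCard F = d * t + 1 := by
      have := residueFieldCard_ne_zero F
      omega
    rw [hq1, pow_succ, pow_mul, hxd, one_pow, one_mul]
  have hχeq : χ ⟨φ * σ * φ⁻¹, hconjmem⟩ = χ ⟨σ, hσ⟩ := Units.ext (hχ1.trans hχ2)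
  have hlamIeq : lamI ⟨φ * σ * φ⁻¹, hconjmem⟩ = lamI ⟨σ, hσ⟩ := hj hχeq
  have := congrArg (fun x : Subgroup.zpowers g₀ => (x : H)) hlamIeq
  simpa only [hlamI] using this

/-- **Decomposition image = inertia image.**  Under the hypotheses of
`apply_frob_conj_eq_of_map_absInertia_eq_zpowers`, if every element of `H` commuting with the
generator `g₀` of `λ(I_F)` already lies in `⟨g₀⟩` (e.g. `g₀` a `5`-cycle in `S₅`), then
`λ(Γ_F) = ⟨g₀⟩ = λ(I_F)`. [cite: DoudMoore2006, §2] -/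
theorem range_eq_zpowers_of_map_absInertia_eq_zpowers {H : Type*} [Group H]
    (lam : absoluteGaloisGroup F →* H)
    (hopen : IsOpen ((lam.ker : Subgroup (absoluteGaloisGroup F)) : Set (absoluteGaloisGroup F)))
    {g₀ : H} (hmap : (absInertia F).map lam = Subgroup.zpowers g₀)
    {d : ℕ} (hd : 0 < d) (hord : orderOf g₀ = d) (hpd : ¬ ringChar 𝓀[F] ∣ d)
    (hq : d ∣ residueFieldCard F - 1)
    (hcent : ∀ x : H, x * g₀ = g₀ * x → x ∈ Subgroup.zpowers g₀) :
    lam.range = Subgroup.zpowers g₀ := by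
  classical
  obtain ⟨φ, hφ⟩ := exists_isAbsArithFrob_holds F
  -- `g₀ = λ s` for some `s ∈ I_F`, and `λ φ` commutes with it
  have hg₀ : g₀ ∈ (absInertia F).map lam := hmap ▸ Subgroup.mem_zpowers g₀
  obtain ⟨s, hs, hsg⟩ := Subgroup.mem_map.mp hg₀
  have hcomm : lam φ * g₀ = g₀ * lam φ := by
    have h := apply_frob_conj_eq_of_map_absInertia_eq_zpowers lam hopen hmap hd hord hpd hq hφ hs
    rw [map_mul, map_mul, map_inv, hsg] at h
    calc lam φ * g₀ = lam φ * g₀ * (lam φ)⁻¹ * lam φ := by group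
      _ = g₀ * lam φ := by rw [h]
  have hφmem : lam φ ∈ Subgroup.zpowers g₀ := hcent _ hcomm
  refine le_antisymm ?_ ?_
  · rintro _ ⟨τ, rfl⟩
    obtain ⟨n, ι, hι, heq⟩ := exists_eq_frob_zpow_mul_of_isOpen_ker lam hopen hφ τ
    rw [heq]
    exact mul_mem (Subgroup.zpow_mem _ hφmem n) (hmap ▸ Subgroup.mem_map_of_mem lam hι)
  · rw [← hmap]
    exact Subgroup.map_le_range lam _

end Literature.NumberTheory.GaloisRepresentations

end
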